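import Summits.Ventures.CertifiedArithmetic.LowPrec.DoubleRoundingFMANearWideCore
import Summits.Ventures.CertifiedArithmetic.LowPrec.DoubleRoundingGmidBelow

/-!
# Double rounding of the FMA through a register with `P_ψ = 3 P_φ - 1` — far core and frame lemmas

HONEST FRAMING: certified error envelopes and provably optimal rounding/accumulation schemes for
low-precision formats under stated cost models; every table by two implementations; no hardware
or vendor claims.

THEOREM D-fma-W′ (`DoubleRoundingFMANearWideCore.lean`: the test and the integer core
`fma_slip_core_nearWide` of the exact regime `g = t + 2P_φ - 1`; `DoubleRoundingFMANearWide.lean`: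
soundness).  This file supplies the pieces between the two:

* `fma_slip_core_far` — the integer core in the FAR regime `g ≥ t + 2P_φ` with only
  `2M ≥ 2^(t+3P_φ)` (the midpoint `μ = M ν` of `φ` may have a SUBNORMAL lower neighbour, where
  THEOREM D-fma-W's `fma_slip_core_wide`, which wants `M ≥ 2^(t+3P_φ)`, does not apply): only the
  patterns (A1) `P = M` and (A2) `P = M - ρ·2^(t+P)`, `C = ρ·(2^P-1)·2^t` survive, and
  `fma_slip_core_nearWide'` — both regimes in one statement;
* the frame lemmas of the record-level proof: the divisibility step `succ_le_of_two_pow_dvd_odd_mul` (`2^(D+1) ∣ u·2^t`, `u` odd ⇒ `t ≥ D+1`),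
  the binade step `manBits_succ_le_of_frame`, the availability count `man_lt_fmaWideCount`
  (shared with D-fma-W's `fmaWideCount`), the significands of patterns (A1)/(A2) (`sig_of_A`, odd
  parts) and (B′) (`sig_of_Bprime`), and the PARITY lemma `toRat_roundNE_gmid_eq_of_parity`: at the
  midpoint above the significand `V'` in frame `k`, a sum `μ - ρ·δ` (`0 < δ < 2^k quantum`) on the
  side `ρ = +1` (below) rounds like `μ` itself when `V'` is EVEN, on the side `ρ = -1` when `V'`
  is ODD (`toRat_roundNE_gmid`, `toRat_roundNE_gmid_odd`, `toRat_roundNE_below_gmid`,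
  `toRat_roundNE_above_gmid`) — so an (A2) slip needs the other parity, which is what
  `fmaTieSig` encodes.

Implementation A = `code/enum/fma_nearwide_law.py` (certificate `DOUBLE-ROUNDING-FMA-NEARWIDE.json`).
References: [MartinDorelMelquiondMuller2013] Property 2.1; [BoldoMelquiond2008] Thm 3;
[Figueroa1995] §3; [Roux2014] §2.  No hardware or vendor claims.
-/

namespace Summit.Ventures.CertifiedArithmetic

open Literature.ComputerArithmetic.FloatingPoint
open Literature.ComputerArithmetic.FloatingPoint.Format
open Literature.ComputerArithmetic.FloatingPoint.MiniFloat

/-! ## §1 The integer core in the far regime -/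

/-- The integer core for `g ≥ t + 2p` with `2M ≥ 2^(t+3p)` (half a binade below THEOREM
D-fma-W's hypothesis): a slip is pattern (A1) `P = M` or pattern (A2) `P = M - ρ·2^(t+p)`,
`C = ρ·(2^p-1)·2^t`, `ρ = ±1`; a coarse addend (`2^(t+1) ∣ C`) cannot slip at all, as
`|C - M| ≤ |N| + |P| < 2^(t+2p) ≤ 2^g`. [this packet] -/
theorem fma_slip_core_far {p k t g : ℕ} {P C M J : ℤ} (hp : 2 ≤ p)
    (hkP : (2:ℤ) ^ k ∣ P) (hPle : |P| ≤ ((2:ℤ) ^ p - 1) ^ 2 * 2 ^ k)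
    (hC : (2:ℤ) ^ (t + 1) ∣ C ∨ |C| ≤ ((2:ℤ) ^ p - 1) * 2 ^ t) (hM : M = (2 * J + 1) * 2 ^ g)
    (hg : t + 2 * p ≤ g) (hMge : (2:ℤ) ^ (t + 3 * p) ≤ 2 * M)
    (hN0 : P + C - M ≠ 0) (hNle : |P + C - M| ≤ (2:ℤ) ^ t) (hfar : (2:ℤ) ^ g ≤ |C - M|) :
    P = M ∨ (∃ ρ : ℤ, (ρ = 1 ∨ ρ = -1) ∧ P = M - ρ * 2 ^ (t + p)
      ∧ C = ρ * (2 ^ p - 1) * 2 ^ t) := by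
  have h4p : (4:ℤ) ≤ 2 ^ p := by
    calc (4:ℤ) = 2 ^ 2 := by norm_num
      _ ≤ 2 ^ p := pow_le_pow_right₀ (by norm_num) hp
  have ht0 : (0:ℤ) < 2 ^ t := by positivity
  have hp0 : (0:ℤ) < 2 ^ p := by positivity
  have hk0 : (0:ℤ) < 2 ^ k := by positivity
  have etp : (2:ℤ) ^ (t + 2 * p) = 2 ^ t * (2 ^ p * 2 ^ p) := by rw [pow_add, pow_mul', sq]
  have hgt : (2:ℤ) ^ t * (2 ^ p * 2 ^ p) ≤ 2 ^ g := etp ▸ pow_le_pow_right₀ (by norm_num) hg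
  have e3p : (2:ℤ) ^ (t + 3 * p) = 2 ^ t * 2 ^ p * (2 ^ p * 2 ^ p) := by
    rw [pow_add, show 3 * p = p + p + p by ring, pow_add, pow_add]; ring
  have hXT : 4 * (2:ℤ) ^ t ≤ 2 ^ p * 2 ^ t := mul_le_mul_of_nonneg_right h4p ht0.le
  rcases hC with hCc | hCs
  · -- a coarse addend cannot slip: `k ≤ t` (else `2^(t+1) ∣ N`), then `|C - M| < 2^(t+2p)`
    exfalso
    have hMt : (2:ℤ) ^ (t + 1) ∣ M := by
      rw [hM]; exact Dvd.dvd.mul_left (pow_dvd_pow 2 (by omega)) _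
    have hkt : k ≤ t := by
      by_contra hkt
      have h1 : (2:ℤ) ^ (t + 1) ∣ P + C - M :=
        dvd_sub (dvd_add ((pow_dvd_pow 2 (by omega)).trans hkP) hCc) hMt
      have h2 := Int.le_of_dvd (abs_pos.mpr hN0) ((dvd_abs _ _).mpr h1)
      rw [pow_succ] at h2; linarith
    have hCM : |C - M| ≤ 2 ^ t + |P| := by
      have e : C - M = (P + C - M) - P := by ring
      rw [e]; exact (abs_sub _ _).trans (add_le_add hNle le_rfl)
    have h2k : (2:ℤ) ^ k ≤ 2 ^ t := pow_le_pow_right₀ (by norm_num) hkt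
    have h3 : ((2:ℤ) ^ p - 1) ^ 2 * 2 ^ k ≤ ((2:ℤ) ^ p - 1) ^ 2 * 2 ^ t :=
      mul_le_mul_of_nonneg_left h2k (sq_nonneg _)
    linarith [hCM, hPle, h3, hXT, hgt, hfar]
  · -- a small addend: patterns (A1) / (A2)
    have hN := abs_le.mp hNle
    have hC' := abs_le.mp hCs
    have hPge : (2:ℤ) ^ (t + 3 * p) - 2 * 2 ^ p * 2 ^ t ≤ 2 * P := by linarith [hN.1, hC'.2]
    have hk : t + p ≤ k := by
      by_contra hk
      have h2k : 2 * (2:ℤ) ^ k ≤ 2 ^ (t + p) := by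
        calc 2 * (2:ℤ) ^ k = 2 ^ (k + 1) := by rw [pow_succ]; ring
          _ ≤ 2 ^ (t + p) := pow_le_pow_right₀ (by norm_num) (by omega)
      have h1 : 2 * P ≤ ((2:ℤ) ^ p - 1) ^ 2 * 2 ^ (t + p) :=
        calc 2 * P ≤ 2 * (((2:ℤ) ^ p - 1) ^ 2 * 2 ^ k) := by linarith [le_abs_self P]
          _ = ((2:ℤ) ^ p - 1) ^ 2 * (2 * 2 ^ k) := by ring
          _ ≤ ((2:ℤ) ^ p - 1) ^ 2 * 2 ^ (t + p) := mul_le_mul_of_nonneg_left h2k (sq_nonneg _)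
      have e2 : (2:ℤ) ^ (t + p) = 2 ^ t * 2 ^ p := pow_add _ _ _
      rw [e2] at h1
      have hA : (0:ℤ) < 2 ^ t * 2 ^ p := mul_pos ht0 hp0
      have hA4 : 4 * (2 ^ t * 2 ^ p) ≤ 2 ^ p * ((2:ℤ) ^ t * 2 ^ p) :=
        mul_le_mul_of_nonneg_right h4p hA.le
      have key : 2 * (2 ^ p * ((2:ℤ) ^ t * 2 ^ p)) ≤ 3 * (2 ^ t * 2 ^ p) := by
        linarith [h1, hPge, e3p]
      linarith [hA, hA4, key]
    have h1 : (2:ℤ) ^ (t + p) ∣ P := (pow_dvd_pow 2 hk).trans hkP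
    have h2 : (2:ℤ) ^ (t + p) ∣ M := by
      rw [hM]; exact Dvd.dvd.mul_left (pow_dvd_pow 2 (by omega)) _
    obtain ⟨w, hw⟩ := dvd_sub h1 h2
    have htp0 : (0:ℤ) < 2 ^ (t + p) := by positivity
    have e3 : (2:ℤ) ^ (t + p) = 2 ^ p * 2 ^ t := by rw [pow_add]; ring
    have hwle : |w| ≤ 1 := by
      have h3 : |P - M| ≤ (2:ℤ) ^ (t + p) := by
        have e : P - M = (P + C - M) - C := by ring
        rw [e, e3]
        calc |P + C - M - C| ≤ |P + C - M| + |C| := abs_sub _ _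
          _ ≤ 2 ^ t + ((2:ℤ) ^ p - 1) * 2 ^ t := add_le_add hNle hCs
          _ = 2 ^ p * 2 ^ t := by ring
      have h4 : (2:ℤ) ^ (t + p) * |w| ≤ 2 ^ (t + p) * 1 := by
        rw [mul_one, ← abs_of_pos htp0, ← abs_mul, ← hw, abs_of_pos htp0]; exact h3
      exact le_of_mul_le_mul_left h4 htp0
    rcases abs_le.mp hwle with ⟨hw1, hw2⟩
    have hw3 : w = 0 ∨ w = -1 ∨ w = 1 := by omega
    rcases hw3 with rfl | hwρ
    · left; linear_combination hw
    · right
      refine ⟨-w, by omega, by linear_combination hw, ?_⟩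
      have hCeq : C = (P + C - M) - w * 2 ^ (t + p) := by linear_combination (-1:ℤ) * hw
      rw [e3] at hCeq
      rcases hwρ with hw0 | hw0 <;> rw [hw0] at hCeq ⊢
      · have hNeq : P + C - M = -(2 ^ t) := by linarith [hC'.2, hN.1]
        rw [hCeq, hNeq]; ring
      · have hNeq : P + C - M = 2 ^ t := by linarith [hC'.1, hN.2]
        rw [hCeq, hNeq]; ring

/-- Both regimes of the near-wide column in one statement: `g + 1 ≥ t + 2p`, `2M ≥ 2^(t+3p)`;
the exact regime `g + 1 = t + 2p` is `fma_slip_core_nearWide`, the far one `fma_slip_core_far`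
(pattern (B′) then carries `g + 1 = t + 2p`). [this packet] -/
theorem fma_slip_core_nearWide' {p k t g γ : ℕ} {P C M J c₁ : ℤ} (hp : 2 ≤ p)
    (hkP : (2:ℤ) ^ k ∣ P) (hPle : |P| ≤ ((2:ℤ) ^ p - 1) ^ 2 * 2 ^ k)
    (hC1 : |C| = c₁ * 2 ^ γ) (hc₁ : c₁ < (2:ℤ) ^ p)
    (hC : (2:ℤ) ^ (t + 1) ∣ C ∨ |C| ≤ ((2:ℤ) ^ p - 1) * 2 ^ t) (hM : M = (2 * J + 1) * 2 ^ g)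
    (htg : t + 2 * p ≤ g + 1) (hMge : (2:ℤ) ^ (t + 3 * p) ≤ 2 * M)
    (hN0 : P + C - M ≠ 0) (hNle : |P + C - M| ≤ (2:ℤ) ^ t) (hfar : (2:ℤ) ^ g ≤ |C - M|) :
    P = M ∨ (∃ ρ : ℤ, (ρ = 1 ∨ ρ = -1) ∧ P = M - ρ * 2 ^ (t + p) ∧ C = ρ * (2 ^ p - 1) * 2 ^ t)
      ∨ (∃ σ ε : ℤ, (σ = 1 ∨ σ = -1) ∧ (ε = 1 ∨ ε = -1) ∧ C = M + σ * 2 ^ g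
          ∧ P = -σ * 2 ^ g + ε * 2 ^ t ∧ k = t ∧ g + 1 = t + 2 * p) := by
  rcases Nat.lt_or_ge g (t + 2 * p) with hlt | hge
  · have hg : g + 1 = t + 2 * p := by omega
    have hMge' : (2:ℤ) ^ (g + p) ≤ M := by
      have e : (2:ℤ) ^ (t + 3 * p) = 2 ^ (g + p) * 2 := by
        rw [show t + 3 * p = (g + p) + 1 by omega, pow_succ]
      linarith
    rcases fma_slip_core_nearWide hp hkP hPle hC1 hc₁ hC hM hg hMge' hN0 hNle hfar with
      h | h | ⟨σ, ε, hσ, hε, hCσ, hPσ, hkt⟩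
    · exact Or.inl h
    · exact Or.inr (Or.inl h)
    · exact Or.inr (Or.inr ⟨σ, ε, hσ, hε, hCσ, hPσ, hkt, hg⟩)
  · rcases fma_slip_core_far hp hkP hPle hC hM hge hMge hN0 hNle hfar with h | h
    · exact Or.inl h
    · exact Or.inr (Or.inl h)

/-! ## §2 Frame lemmas -/

/-- `2^(D+1) ∣ u·2^t` with `u` odd forces `D + 1 ≤ t`. [folklore] -/
theorem succ_le_of_two_pow_dvd_odd_mul {D t : ℕ} {u : ℤ} (hu : Odd u)
    (h : (2:ℤ) ^ (D + 1) ∣ u * 2 ^ t) : D + 1 ≤ t := by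
  by_contra hlt
  have h1 : (2:ℤ) ^ t * 2 ∣ 2 ^ t * u := by
    rw [← pow_succ, mul_comm ((2:ℤ) ^ t) u]; exact (pow_dvd_pow 2 (by omega)).trans h
  have h2 : (2:ℤ) ∣ u := (mul_dvd_mul_iff_left (by positivity)).mp h1
  exact Int.not_even_iff_odd.mpr hu (even_iff_two_dvd.mpr h2)

/-- The binade step: `2^(m_ψ+t+1) ≤ M = (2V'+1)·2^g`, `V' < 2^(m+1)`, `g = e₁ + D`, `t ≥ D + 1`
give `m_ψ + 1 ≤ m + e₁` (the midpoint lies in a binade `≥ 2^(m_ψ+1)` quanta). [this packet] -/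
theorem manBits_succ_le_of_frame {mψ m t g e₁ D V' : ℕ} {M : ℤ}
    (hMge : (2:ℤ) ^ (mψ + t + 1) ≤ M) (hMg : M = (2 * (V' : ℤ) + 1) * 2 ^ g)
    (hV' : V' < 2 ^ (m + 1)) (hg : g = e₁ + D) (htD : D + 1 ≤ t) : mψ + 1 ≤ m + e₁ := by
  have h1 : M < (2:ℤ) ^ (m + 2 + g) := by
    rw [hMg, pow_add]
    have h' : ((V' : ℕ) : ℤ) < 2 ^ (m + 1) := by exact_mod_cast hV'
    have h3 : (2 * (V' : ℤ) + 1) < 2 ^ (m + 2) := by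
      rw [show m + 2 = (m + 1) + 1 by ring, pow_succ]; linarith
    exact mul_lt_mul_of_pos_right h3 (pow_pos (by norm_num) g)
  have h2 := (pow_lt_pow_iff_right₀ (by norm_num : (1:ℤ) < 2)).mp (hMge.trans_lt h1)
  omega

/-- Availability of the midpoint above a normal datum `v` of a binade `≥ 2^(m_ψ+1)` quanta whose
upper neighbour `v + ulp` is finite: `man v < fmaWideCount φ ψ`. [this packet] -/
theorem man_lt_fmaWideCount {φ ψ : Format} (v : MiniFloat φ) (he : 1 ≤ v.expCode)
    (hwin : ψ.manBits + 1 ≤ φ.manBits + (v.expCode - 1))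
    (hu : (2 ^ φ.manBits + v.man + 1) * 2 ^ (v.expCode - 1) ≤ φ.maxScaled) :
    v.man < fmaWideCount φ ψ := by
  have hele := v.expCode_le
  have hman := v.man_lt
  unfold fmaWideCount
  rw [if_neg (by omega)]
  by_cases hc2 : φ.manBits + φ.emaxCode = ψ.manBits + 2
  · rw [if_pos hc2]
    have hee : v.expCode = φ.emaxCode := by omega
    unfold Format.maxScaled Format.scaled at hu
    rw [if_neg (by omega : ¬ φ.emaxCode = 0), hee] at hu
    have h4 := Nat.le_of_mul_le_mul_right hu (by positivity)
    omega
  · rw [if_neg hc2]; exact hman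

/-- Patterns (A1)/(A2) on odd parts: `P = M - ρ·2^(t+p)` (`ρ = 0`: (A1); `ρ = ±1`: (A2)),
`M = (2V'+1)·2^g`, `g = t + p + m` (`m ≥ 1`), `P.natAbs = 2^k·n` with `n` odd ⇒ `n = 2V'+1`
(A1), `n = (2V'+1)·2^m - ρ` (A2) (uniqueness of the odd part). [this packet] -/
theorem sig_of_A {k t p m g V' n : ℕ} {P M ρ : ℤ} (hm : 1 ≤ m) (hρ : ρ = 0 ∨ ρ = 1 ∨ ρ = -1)
    (hP : P = M - ρ * 2 ^ (t + p)) (hM : M = (2 * (V' : ℤ) + 1) * 2 ^ g) (hg : g = t + p + m)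
    (hPabs : P.natAbs = 2 ^ k * n) (hn : Odd n) :
    (ρ = 0 ∧ n = 2 * V' + 1) ∨ (ρ ≠ 0 ∧ (n : ℤ) = (2 * V' + 1) * 2 ^ m - ρ) := by
  -- uniqueness of the odd part (folklore; cf. `Literature.NumberTheory.Automorphic.
  -- two_pow_mul_odd_inj`, not imported to keep this file's closure inside the cell)
  have hinj : ∀ {k g A B : ℕ}, Odd A → Odd B → 2 ^ k * A = 2 ^ g * B → A = B := by
    intro k g A B hA hB h
    have key : ∀ {k g A B : ℕ}, Odd A → k < g → 2 ^ k * A ≠ 2 ^ g * B := by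
      intro k g A B hA hlt h
      obtain ⟨d, rfl⟩ := Nat.exists_eq_add_of_lt hlt
      have h' : A = 2 ^ (d + 1) * B := by
        apply Nat.eq_of_mul_eq_mul_left (Nat.two_pow_pos k)
        rw [h, show k + d + 1 = k + (d + 1) by ring, pow_add, mul_assoc]
      exact hA.not_two_dvd_nat ⟨2 ^ d * B, by rw [h', pow_succ]; ring⟩
    rcases lt_trichotomy k g with hlt | rfl | hgt
    · exact absurd h (key hA hlt)
    · exact Nat.eq_of_mul_eq_mul_left (Nat.two_pow_pos k) h
    · exact absurd h.symm (key hB hgt)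
  have key : ∀ (U e : ℕ), Odd U → P = ((2 ^ e * U : ℕ) : ℤ) → n = U := by
    intro U e hU hPU
    have h1 : P.natAbs = 2 ^ e * U := by rw [hPU, Int.natAbs_natCast]
    exact hinj hn hU (hPabs.symm.trans h1)
  have hE1 : 1 ≤ (2 * V' + 1) * 2 ^ m := Nat.one_le_iff_ne_zero.mpr (by positivity)
  have hEe : Even ((2 * V' + 1) * 2 ^ m) := by
    rw [show m = (m - 1) + 1 by omega, pow_succ]; exact ⟨(2 * V' + 1) * 2 ^ (m - 1), by ring⟩
  rcases hρ with rfl | rfl | rfl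
  · left
    exact ⟨rfl, key (2 * V' + 1) g (odd_two_mul_add_one V') (by rw [hP, hM]; push_cast; ring)⟩
  · right; refine ⟨one_ne_zero, ?_⟩
    have h := key ((2 * V' + 1) * 2 ^ m - 1) (t + p) (Nat.Even.sub_odd hE1 hEe odd_one)
      (by rw [hP, hM, hg, pow_add, pow_add]; push_cast [Nat.cast_sub hE1]; ring)
    rw [h]; push_cast [Nat.cast_sub hE1]; ring
  · right; refine ⟨by norm_num, ?_⟩
    have h := key ((2 * V' + 1) * 2 ^ m + 1) (t + p) (hEe.add_odd odd_one)
      (by rw [hP, hM, hg, pow_add, pow_add]; push_cast; ring)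
    rw [h]; push_cast; ring

/-- Pattern (B′) on odd parts: `P = -σ·2^g + ε·2^t`, `g = t + (2m+1)`, `P.natAbs = 2^t·n` ⇒
`n = 2^(2m+1) - σε = 2^(2m+1) ∓ 1`. [this packet] -/
theorem sig_of_Bprime {t m g n : ℕ} {P σ ε : ℤ} (hσ : σ = 1 ∨ σ = -1) (hε : ε = 1 ∨ ε = -1)
    (hP : P = -σ * 2 ^ g + ε * 2 ^ t) (hg : g = t + (2 * m + 1)) (hPabs : P.natAbs = 2 ^ t * n) :
    n = 2 ^ (2 * m + 1) - 1 ∨ n = 2 ^ (2 * m + 1) + 1 := by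
  have h2w : ((2:ℤ) ^ t).natAbs = 2 ^ t := by rw [Int.natAbs_pow]; rfl
  have hσabs : σ.natAbs = 1 := by rcases hσ with rfl | rfl <;> rfl
  have key : ∀ U : ℕ, P = -σ * 2 ^ t * (U : ℤ) → n = U := by
    intro U hU
    have h1 : P.natAbs = 2 ^ t * U := by
      rw [hU, Int.natAbs_mul, Int.natAbs_mul, Int.natAbs_neg, hσabs, h2w, Int.natAbs_natCast]
      ring
    exact Nat.eq_of_mul_eq_mul_left (Nat.two_pow_pos t) (hPabs.symm.trans h1)
  have h1le : 1 ≤ 2 ^ (2 * m + 1) := Nat.one_le_two_pow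
  rcases hε with rfl | rfl <;> rcases hσ with rfl | rfl
  · left; apply key; rw [hP, hg, pow_add]; push_cast [Nat.cast_sub h1le]; ring
  · right; apply key; rw [hP, hg, pow_add]; push_cast; ring
  · right; apply key; rw [hP, hg, pow_add]; push_cast; ring
  · left; apply key; rw [hP, hg, pow_add]; push_cast [Nat.cast_sub h1le]; ring

/-- PARITY at a midpoint (frame `k`, significand `2^m ≤ V' < 2^(m+1)`, the upper neighbour
finite): the sum `μ - ρ·δ` with `0 < δ < 2^k·quantum` rounds in `φ` exactly like the midpoint
`μ` itself when `ρ = +1` and `V'` is even (both give the lower neighbour) or `ρ = -1` and `V'` is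
odd (both give the upper one) — no slip on that side. [this packet] -/
theorem toRat_roundNE_gmid_eq_of_parity {φ : Format} (h1 : 1 ≤ φ.manBits) {V' k : ℕ}
    (htlo : 2 ^ φ.manBits ≤ V') (hthi : V' < 2 ^ (φ.manBits + 1))
    (hu : (V' + 1) * 2 ^ (k + 1) ≤ φ.maxScaled) {δ : ℚ} (hδ0 : 0 < δ)
    (hδ : δ < 2 ^ k * φ.quantum) {ρ : ℤ} (hpar : (ρ = 1 ∧ Even V') ∨ (ρ = -1 ∧ Odd V')) :
    (roundNE φ ((((2 * V' + 1) * 2 ^ k : ℕ) : ℚ) * φ.quantum)).toRat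
      = (roundNE φ ((((2 * V' + 1) * 2 ^ k : ℕ) : ℚ) * φ.quantum - ρ * δ)).toRat := by
  rcases hpar with ⟨rfl, ht⟩ | ⟨rfl, ht⟩
  · rw [toRat_roundNE_gmid h1 ht htlo hthi hu, Int.cast_one, one_mul,
      toRat_roundNE_below_gmid htlo hthi hu hδ0 hδ]
  · rw [toRat_roundNE_gmid_odd h1 ht htlo hthi hu, Int.cast_neg, Int.cast_one, neg_mul, one_mul,
      sub_neg_eq_add, toRat_roundNE_above_gmid htlo hthi hu hδ0 hδ]

end Summit.Ventures.CertifiedArithmetic
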